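import Summits.BirchSwinnertonDyer.Rank1Residual.Supersingular.SprungConstantTerm
import Summits.BirchSwinnertonDyer.Rank1Residual.Supersingular.SharpFlatRankZero
import Literature.NumberTheory.EllipticCurves.SupersingularDensitySerreFrobeniusProofs
import HarnessLib

/-!
# X8 (`p = 3` good supersingular, `a_3 = ±3`), analytic rank `0`: the ♯/♭ rank-zero chain with
# Sprung's REAL `L♯`, `L♭` — the interpolation binder (P•) DISCHARGED
# (cell `b2b-bsdres`, supersingular family, prover B = unit `b2b-bsdres-additive-p3`, gen 3)

HONEST FRAMING (run/shared/lean/b2b/bsd-rank1-residual/, verbatim in every file): the goal of the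
cell is to DELETE the COMBINATION-SHAPED residual classes of the Birch–Swinnerton-Dyer formula for
ALL analytic-rank `≤ 1` elliptic curves over `ℚ` — "full BSD formula for every rank `≤ 1` curve in
class `C`" assembled STRICTLY from published theorems — so that the rank-`≤ 1` remainder becomes
exactly the CONSTRUCTION-SHAPED classes, which are TYPED (missing-input `Prop`s), NOT attempted.
This is not "finishing BSD". THEOREMS ONLY (no definition, no named fact, nothing about any curve is
asserted); X8 stays CONSTRUCTION-SHAPED; nothing booked.

## What this file does

Gens 1–2 landed the X8 rank-`0` reading on an ABSTRACT datum (`Supersingular/SharpFlatRankZero.lean`,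
p207337: `SignedDatum = (ξ, L, c)` with (K•) Euler characteristic, (P•) interpolation, (MC↓)). This
gen vendored Sprung's ♯/♭ `p`-adic `L`-functions ON THE REAL SIDE (`Sprung2017.IsSprungPair`: the
Mazur–Tate characterisation `θ_n ≡ −(u_n L♯ + v_n L♭) (mod ω_n)`, Sprung ANT 2017 Thm. 1.12 /
Cor. 4.4–4.5) and PROVED (P•) for every such pair (`Supersingular/SprungConstantTerm.lean`:
`L^•(0) = c_• · [0]⁺_f`, `c_♯ = −a_p² + 2a_p + p − 1`, `c_♭ = 2 − a_p`). Here: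

* `ClassX8.frobeniusTrace_eq_three_or` — on X8, `a_3 = 3 ∨ a_3 = −3` (Hasse `a_3² ≤ 12`, `3 ∣ a_3 ≠ 0`);
  `ClassX8.chromaticConst_eq` / `ClassX8.not_dvd_chromaticConst` — **`c_♯ ∈ {−1, −13}`,
  `c_♭ ∈ {−1, 5}`: BOTH chromatic constants are `3`-adic units at EVERY X8 pair**, so both colours
  interpolate `L(E,1)/Ω` up to a unit (Sprung's table after Cor. 4.11, read at `p = 3`, `a_3 = ±3`);
* `missingLowerBoundAt_of_chromaticLowerDivisibility` — the rank-zero chain with the REAL `L^•`: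
  `p` odd good, `E[p]` irreducible, `L(E,1) ≠ 0`, `f` the newform of `E` with period ratio `ϖ`
  (`ϖ·Ω_E = Ω⁺_f`), `(L♯, L♭)` ANY Sprung pair for `a_p(E)`, a colour `•` with `p ∤ c_•`; displayed
  binders: an element `ξ ∈ Λ` with Kim/Sprung's Euler-characteristic identity (K•) (in refereed print
  for the ♯/♭ Selmer groups: Sprung, Adv. Math. 449 (2024) Lemmas 5.5–5.9 — but the ♯/♭ SELMER
  objects are not tree vocabulary, so `ξ` stays a datum) and the Néron-normalised Eisenstein
  divisibility (MC↓)• `ι ξ = ϖ · ι(L^• · h)` ⇒ `MissingLowerBoundAt W p`. The period ratio `ϖ`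
  cancels (no Manin input), exactly as in prover A's `missingLowerBoundAt_of_kobayashiLowerDivisibility`
  (p209365) for the `±` objects;
* `X8.bsdp_of_chromaticLowerDivisibility_of_surj_of_analyticRank_eq_zero` (+ `_of_semistable_`,
  surjectivity automatic by Serre Prop. 21 i)) — with Wuthrich 2014 Prop. 21 (PUB) ⇒ `BSDp W 3`;
  `X8.missingInputAt_of_chromaticLowerDivisibility_of_surj` — typed currency.

So the X8 ∩ {r_an = 0, surj(3)} residue now READS, on the real analytic objects: "(MC↓)• for one
colour, granted (K•) for Sprung's `Sel^•`" — (P•) is a theorem, (K•) is in refereed print (objects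
absent from the tree), (MC↓)• is the OPEN input (Sprung 2024 Thm. 1.1 conditional on his Conj. 3.33;
CCSS arXiv:1804.10993 PRE; per pair via a unit Kurihara number only modulo the unbookable KKS@3 bridge,
referee R96.3/R97.3). Non-vacuity of "ANY Sprung pair": `Sprung2017.thm112_exists_isSprungPair`
(named fact, this gen) — not needed by the theorems below, which hold for every pair.

References: [Sprung2017] Thm. 1.12, Cor. 4.4–4.5, Cor. 4.10–4.11 (table); [Sprung2012] Thm. 1.2,
Main Conj. 1.3 / 7.21, Thm. 1.4, Prop. 7.19; [Sprung2024] Lemmas 5.5–5.9 (pp. 40–41); [Wuthrich2014]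
Prop. 21; [Serre1972] Props. 12, 21; [SilvermanAEC2009] Thm. V.1.1; [Miller2011LMS] Def. 1.1.
Memo: `HOME/b2b-bsdres-additive-p3/X8-ROUTE-B.md` §8 (gen 3).
-/

set_option autoImplicit false

noncomputable section

open scoped Classical MatrixGroups ModularForm

open CongruenceSubgroup WeierstrassCurve Literature.NumberTheory.EllipticCurves
  Literature.NumberTheory.EllipticCurves.ModularForms
  Literature.NumberTheory.EllipticCurves.Rank1Residual
  Literature.NumberTheory.EllipticCurves.Rank1Residual.Typed
  Literature.NumberTheory.EllipticCurves.Sprung2017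

namespace Summit.BirchSwinnertonDyer.Rank1Residual.Supersingular

/-! ### The chromatic constants on X8 are `3`-adic units -/

section X8Constants

variable (W : WeierstrassCurve ℚ) [W.IsElliptic] [W.IsGloballyMinimal] (p : ℕ) [Fact p.Prime]

/-- **On X8, `a_3 = ±3`**: good supersingular reduction at `3` means `3 ∣ a_3` (class predicate),
`a_3 ≠ 0` (class predicate), and Hasse's bound `a_3² ≤ 4·3 = 12` (`frobeniusTrace_sq_le_four_mul`,
Silverman *AEC* Thm. V.1.1) leaves `a_3 ∈ {−3, 3}`. [cite: SilvermanAEC2009, Thm. V.1.1] -/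
theorem ClassX8.frobeniusTrace_eq_three_or (hX : ClassX8 W p) :
    W.frobeniusTrace 3 = 3 ∨ W.frobeniusTrace 3 = -3 := by
  obtain ⟨-, ⟨hgood, hdvd⟩, hne⟩ := hX
  have hsq : W.frobeniusTrace 3 ^ 2 ≤ 4 * (3 : ℕ) := W.frobeniusTrace_sq_le_four_mul 3 hgood
  obtain ⟨k, hk⟩ := hdvd
  rw [hk] at hsq hne ⊢
  push_cast at hsq
  have h1 : -1 ≤ k := by nlinarith
  have h2 : k ≤ 1 := by nlinarith
  interval_cases k
  · right; norm_num
  · exact absurd rfl hne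
  · left; norm_num

/-- **The chromatic constants of an X8 pair**: `c_♯(3, a_3) ∈ {−1, −13}` and `c_♭(3, a_3) ∈ {−1, 5}`
(`a_3 = 3`: `c_♯ = −9+6+3−1 = −1`, `c_♭ = −1`; `a_3 = −3`: `c_♯ = −13`, `c_♭ = 5`) — Sprung's table
after Cor. 4.11 read at `p = 3`, `a_3 = ±3`. [cite: Sprung2017, Cor. 4.11 (table of special values)] -/
theorem ClassX8.chromaticConst_eq (hX : ClassX8 W p) (c : Chroma) :
    chromaticConst 3 (W.frobeniusTrace 3) c =
      (if W.frobeniusTrace 3 = 3 then (match c with | .sharp => -1 | .flat => -1)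
        else (match c with | .sharp => -13 | .flat => 5)) := by
  rcases ClassX8.frobeniusTrace_eq_three_or W p hX with h | h <;> cases c <;> simp [h]

/-- **Both chromatic constants are `3`-adic units on X8**: `3 ∤ c_•(3, a_3)` for `• ∈ {♯, ♭}`
(`c ∈ {−1, −13, 5}`), so BOTH colours of Sprung's pair interpolate `L(E,1)/Ω` up to a `3`-adic unit —
the hypothesis `p ∤ c` of the rank-zero chain holds for either colour at every X8 pair.
[cite: Sprung2017, Cor. 4.11 (table of special values)] -/
theorem ClassX8.not_dvd_chromaticConst (hX : ClassX8 W p) (c : Chroma) :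
    ¬ (3 : ℤ) ∣ chromaticConst 3 (W.frobeniusTrace 3) c := by
  rw [ClassX8.chromaticConst_eq W p hX c]
  split_ifs <;> cases c <;> decide

/-- The same at the class's own prime symbol `p` (`= 3`). [cite: Sprung2017, Cor. 4.11 (table of special values)] -/
theorem ClassX8.not_dvd_chromaticConst' (hX : ClassX8 W p) (c : Chroma) :
    ¬ (p : ℤ) ∣ chromaticConst p (W.frobeniusTrace p) c := by
  have hp3 : p = 3 := hX.1
  subst hp3
  exact ClassX8.not_dvd_chromaticConst W 3 hX c

end X8Constants

/-! ### The ♯/♭ rank-zero chain with the REAL `L^•` -/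

section Chain

variable (W : WeierstrassCurve ℚ) [W.IsElliptic] [W.IsGloballyMinimal] (p : ℕ) [Fact p.Prime]

/-- **The ♯/♭ rank-zero chain (lower half) with Sprung's real `L^•`.** Let `p` be an odd prime of
good reduction of `E = W`, `E[p]` irreducible (so `p ∤ #E(ℚ)_tors`), `L(E,1) ≠ 0`; let `f` be the
newform of `E` (`IsNewformOf W f`) and `ϖ ∈ ℚ` the period ratio `ϖ·Ω_E = Ω⁺_f`; let `(L♯, L♭)` be
ANY Sprung pair for the trace `a_p(E)` (`IsSprungPair`, Sprung 2017 Thm. 1.12 / Cor. 4.4) and `•` a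
colour with `p ∤ c_•(p, a_p)`. Displayed binders (the ♯/♭ SELMER side is not tree vocabulary): an
element `ξ ∈ Λ` — read: a characteristic power series of `Hom(Sel^•(E/ℚ_∞), ℚ_p/ℤ_p)`, `Λ`-torsion
by Sprung 2012 Thm. 1.2 — with the Euler-characteristic identity (K•)
`ξ(0) ∼ #Sel_{p^∞}(E/ℚ)·∏c_ℓ` (Sprung 2024 Lemmas 5.5–5.9, refereed print), and the
Néron-normalised Eisenstein divisibility (MC↓)• `ι ξ = ϖ · ι(L^• · h)`, `h ∈ Λ`. CONCLUSION:
`ord_p #Ш_an ≤ ord_p #Ш` (`MissingLowerBoundAt W p`). Chain: `ξ(0) = ϖ · L^•(0) · h(0) =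
c_• · t · h(0)` with `t = ϖ·[0]⁺_f = L(E,1)/Ω_E` — (P•) is the THEOREM
`constantCoeff_chromaticL_of_isSprungPair_of_isNewformOf` —, `h(0) ∈ ℤ_p`, `p ∤ c_•`, so
`ord_p t ≤ ord_p ξ(0) = ord_p ∏c_ℓ + ord_p #Ш` ((K•) with GZK: `#Sel_{p^∞} = #Ш[p^∞]`); then
`#Ш_an = t·#tors²/∏c`, `p ∤ #tors`. The period ratio `ϖ` cancels. Shape of prover A's
`missingLowerBoundAt_of_kobayashiLowerDivisibility` (p209365) with Pollack's pair replaced by Sprung's.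
[cite: Sprung2017, Thm. 1.12 and Cor. 4.11 (table)] [cite: Sprung2012, Thm. 1.2 and Main Conj. 1.3]
[cite: Sprung2024, Lemmas 5.5–5.9 (pp. 40–41)] [cite: Miller2011LMS, Def. 1.1] -/
theorem missingLowerBoundAt_of_chromaticLowerDivisibility
    (hGZK : rank_eq_analyticRank_of_analyticRank_le_one)
    (hp : p ≠ 2) (hgood : W.HasGoodReductionAtPrime p)
    (hirr : W.HasIrreducibleModPGaloisRep p) (hL : W.entireLFunction 1 ≠ 0)
    {N : ℕ} [NeZero N] {f : CuspForm (Gamma0 N) 2} (hf : IsNewformOf W f)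
    {ϖ : ℚ} (hϖ : (ϖ : ℝ) * W.realPeriodRat = plusPeriod f)
    {Lsharp Lflat : IwasawaAlgebra p} (hSP : IsSprungPair f p (W.frobeniusTrace p) Lsharp Lflat)
    (c : Chroma) (hc : ¬ (p : ℤ) ∣ chromaticConst p (W.frobeniusTrace p) c)
    (ξ : IwasawaAlgebra p) (hK : (⟨ξ, 0, 0⟩ : SignedDatum W p).EulerCharacteristic)
    (hdiv : ∃ h : IwasawaAlgebra p, iwasawaToPowerSeries p ξ =
      PowerSeries.C (ϖ : ℚ_[p]) * iwasawaToPowerSeries p (chromaticL c Lsharp Lflat * h)) :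
    MissingLowerBoundAt W p := by
  have hpP : p.Prime := Fact.out
  have hr : W.analyticRank = 0 := analyticRank_eq_zero_of_entireLFunction_one_ne_zero W hL
  have hΩpos : 0 < W.realPeriodRat := W.realPeriodRat_pos_holds
  -- `t = ϖ · [0]⁺_f = L(E,1)/Ω_E`
  set s : ℚ := ratPlusSymbol f 0 with hs_def
  set t : ℚ := ϖ * s with ht_def
  have hLval : W.entireLFunction 1 = (((s : ℝ) * plusPeriod f : ℝ) : ℂ) := hf.entireLFunction_one_eq
  have ht : W.entireLFunction 1 / (W.realPeriodRat : ℂ) = ((t : ℚ) : ℂ) := by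
    rw [hLval, ← hϖ, div_eq_iff (Complex.ofReal_ne_zero.mpr hΩpos.ne'), ht_def]
    push_cast
    ring
  have hs0 : s ≠ 0 := by
    intro h0
    apply hL
    rw [hLval, h0]
    simp
  have hϖ0 : ϖ ≠ 0 := by
    intro h0
    rw [h0, Rat.cast_zero, zero_mul] at hϖ
    exact (IsNewform0.plusPeriod_pos_holds hf.1 hf.coeffField_eq_bot).ne' hϖ.symm
  have ht0 : t ≠ 0 := mul_ne_zero hϖ0 hs0
  -- (K•): `ξ(0) ≠ 0` and `ord_p ξ(0) = ord_p ∏c + ord_p #Ш`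
  obtain ⟨hξ0ne, hvξ⟩ := valuation_constantCoeff_xi W p hGZK hL ⟨ξ, 0, 0⟩ hK
  -- (MC↓)• and (P•): `ξ(0) = ϖ · L^•(0) · h(0) = c_• · t · h(0)`
  obtain ⟨h, hιξ⟩ := hdiv
  have hLc := constantCoeff_chromaticL_of_isSprungPair_of_isNewformOf hp hf hgood hSP c
  have hξ0 : ((PowerSeries.constantCoeff ξ : ℤ_[p]) : ℚ_[p]) =
      (chromaticConst p (W.frobeniusTrace p) c : ℚ_[p]) * ((t : ℚ) : ℚ_[p]) *
        ((PowerSeries.constantCoeff h : ℤ_[p]) : ℚ_[p]) := by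
    have hcc := congrArg PowerSeries.constantCoeff hιξ
    rw [constantCoeff_iwasawaToPowerSeries, map_mul, PowerSeries.constantCoeff_C,
      constantCoeff_iwasawaToPowerSeries, map_mul, PadicInt.coe_mul, hLc] at hcc
    rw [hcc, ht_def]
    push_cast
    ring
  -- valuations
  have hcne : (chromaticConst p (W.frobeniusTrace p) c : ℚ_[p]) ≠ 0 := by
    have : chromaticConst p (W.frobeniusTrace p) c ≠ 0 := fun h0 ↦ hc (by rw [h0]; exact dvd_zero _)
    exact_mod_cast this
  have htQ0 : ((t : ℚ) : ℚ_[p]) ≠ 0 := by exact_mod_cast ht0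
  have hh0 : ((PowerSeries.constantCoeff h : ℤ_[p]) : ℚ_[p]) ≠ 0 := fun h0 ↦
    hξ0ne (by rw [hξ0, h0, mul_zero])
  have hval := congrArg Padic.valuation hξ0
  rw [Padic.valuation_mul (mul_ne_zero hcne htQ0) hh0, Padic.valuation_mul hcne htQ0,
    Padic.valuation_intCast, padicValInt.eq_zero_of_not_dvd hc, Padic.valuation_ratCast, hvξ] at hval
  have hhnn := valuation_coe_padicInt_nonneg _ hh0
  have hmain : padicValRat p t ≤ (padicValNat p W.tamagawaProduct : ℤ) + padicValNat p W.shaOrder := by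
    simp only [Nat.cast_zero, zero_add] at hval
    linarith
  refine ⟨t * (W.torsionOrder : ℚ) ^ 2 / (W.tamagawaProduct : ℚ),
    shaAn_eq_of_analyticRank_eq_zero W hGZK hr ht, ?_⟩
  rw [padicValRat_shaAn_witness W p hirr ht0]
  linarith

/-- **X8 ∧ `r_an = 0` ∧ surj(3): `BSD(E,3)` from ONE chromatic divisibility for Sprung's real `L^•`.**
On class X8 (`p = 3`, good supersingular, `a_3 = ±3`) in analytic rank `0` with `ρ̄_{E,3}` onto, granted
Wuthrich 2014 Prop. 21 (`hW`, PUB: the upper bound), GZK, modularity: for `f` the newform of `E`,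
`ϖ·Ω_E = Ω⁺_f`, ANY Sprung pair `(L♯, L♭)`, EITHER colour `•` (both `c_•` are `3`-adic units,
`ClassX8.not_dvd_chromaticConst'`), an element `ξ` with (K•) and the Eisenstein divisibility
`ι ξ = ϖ·ι(L^• h)` give Miller's `BSDp W p`. Irreducibility (`ClassX8.irr'`) and `3 ∣ a_3` are
automatic. The OPEN input is (MC↓)• alone (granted (K•) for the absent Selmer objects). Per pair;
NOT a class theorem. [cite: Wuthrich2014, Prop. 21 (p. 400)] [cite: Sprung2017, Thm. 1.12 and Cor. 4.11]
[cite: Sprung2012, Main Conj. 1.3 and §7] [cite: Serre1972, §1.11 Prop. 12] [cite: Miller2011LMS, Def. 1.1] -/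
theorem X8.bsdp_of_chromaticLowerDivisibility_of_surj_of_analyticRank_eq_zero
    (hW : Wuthrich2014.sha_dvd_analyticSha)
    (hGZK : rank_eq_analyticRank_of_analyticRank_le_one) (hmod : hasEntireLFunction_rat)
    (hX : ClassX8 W p) (hs : Surj W p) (h0 : W.analyticRank = 0)
    {N : ℕ} [NeZero N] {f : CuspForm (Gamma0 N) 2} (hf : IsNewformOf W f)
    {ϖ : ℚ} (hϖ : (ϖ : ℝ) * W.realPeriodRat = plusPeriod f)
    {Lsharp Lflat : IwasawaAlgebra p} (hSP : IsSprungPair f p (W.frobeniusTrace p) Lsharp Lflat)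
    (c : Chroma) (ξ : IwasawaAlgebra p) (hK : (⟨ξ, 0, 0⟩ : SignedDatum W p).EulerCharacteristic)
    (hdiv : ∃ h : IwasawaAlgebra p, iwasawaToPowerSeries p ξ =
      PowerSeries.C (ϖ : ℚ_[p]) * iwasawaToPowerSeries p (chromaticL c Lsharp Lflat * h)) :
    BSDp W p := by
  have hL : W.entireLFunction 1 ≠ 0 := (W.analyticRank_eq_zero_iff_holds (hmod W)).1 h0
  have hgood : W.HasGoodReductionAtPrime p := by
    obtain ⟨hp3, hss, _⟩ := hX
    subst hp3
    exact hss.1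
  have hp2 : p ≠ 2 := by have := hX.1; omega
  exact X8.bsdp_of_missingLowerBoundAt_of_surj W p hW hGZK hmod hX hs h0
    (missingLowerBoundAt_of_chromaticLowerDivisibility W p hGZK hp2 hgood (ClassX8.irr' W p hX) hL
      hf hϖ hSP c (ClassX8.not_dvd_chromaticConst' W p hX c) ξ hK hdiv)

/-- **X8 ∩ {sst} ∧ `r_an = 0`: `BSD(E,3)` from ONE chromatic divisibility for Sprung's real `L^•`**,
surjectivity of `ρ̄_{E,3}` being automatic for semistable `E` (`ClassX8.surj_of_semistable`, Serre
1972 §5.4 Prop. 21 i)). Per pair; NOT a class theorem. [cite: Wuthrich2014, Prop. 21 (p. 400)]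
[cite: Serre1972, §5.4 Prop. 21 i)] [cite: Sprung2017, Thm. 1.12 and Cor. 4.11] [cite: Miller2011LMS, Def. 1.1] -/
theorem X8.bsdp_of_chromaticLowerDivisibility_of_semistable_of_analyticRank_eq_zero
    (hW : Wuthrich2014.sha_dvd_analyticSha)
    (hGZK : rank_eq_analyticRank_of_analyticRank_le_one) (hmod : hasEntireLFunction_rat)
    (hX : ClassX8 W p) (hsst : Semistable W) (h0 : W.analyticRank = 0)
    {N : ℕ} [NeZero N] {f : CuspForm (Gamma0 N) 2} (hf : IsNewformOf W f)
    {ϖ : ℚ} (hϖ : (ϖ : ℝ) * W.realPeriodRat = plusPeriod f)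
    {Lsharp Lflat : IwasawaAlgebra p} (hSP : IsSprungPair f p (W.frobeniusTrace p) Lsharp Lflat)
    (c : Chroma) (ξ : IwasawaAlgebra p) (hK : (⟨ξ, 0, 0⟩ : SignedDatum W p).EulerCharacteristic)
    (hdiv : ∃ h : IwasawaAlgebra p, iwasawaToPowerSeries p ξ =
      PowerSeries.C (ϖ : ℚ_[p]) * iwasawaToPowerSeries p (chromaticL c Lsharp Lflat * h)) :
    BSDp W p := by
  have hs : Surj W p := by
    have hp3 : p = 3 := hX.1
    subst hp3
    exact ClassX8.surj_of_semistable W 3 hX hsst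
  exact X8.bsdp_of_chromaticLowerDivisibility_of_surj_of_analyticRank_eq_zero W p hW hGZK hmod hX hs
    h0 hf hϖ hSP c ξ hK hdiv

/-- **Bookkeeping into the typed currency**: in analytic rank `0` with surjective image, the chromatic
divisibility for Sprung's real `L^•` (granted (K•)) delivers `X8.MissingInputAt W p` (`Typed/X8.lean`:
there the missing input IS `MissingLowerBoundAt W p`). [cite: Sprung2017, Thm. 1.12 and Cor. 4.11]
[cite: Sprung2012, Main Conj. 1.3 and §7] [cite: Miller2011LMS, Def. 1.1] -/
theorem X8.missingInputAt_of_chromaticLowerDivisibility_of_surj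
    (hGZK : rank_eq_analyticRank_of_analyticRank_le_one) (hmod : hasEntireLFunction_rat)
    (hX : ClassX8 W p) (hs : Surj W p) (h0 : W.analyticRank = 0)
    {N : ℕ} [NeZero N] {f : CuspForm (Gamma0 N) 2} (hf : IsNewformOf W f)
    {ϖ : ℚ} (hϖ : (ϖ : ℝ) * W.realPeriodRat = plusPeriod f)
    {Lsharp Lflat : IwasawaAlgebra p} (hSP : IsSprungPair f p (W.frobeniusTrace p) Lsharp Lflat)
    (c : Chroma) (ξ : IwasawaAlgebra p) (hK : (⟨ξ, 0, 0⟩ : SignedDatum W p).EulerCharacteristic)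
    (hdiv : ∃ h : IwasawaAlgebra p, iwasawaToPowerSeries p ξ =
      PowerSeries.C (ϖ : ℚ_[p]) * iwasawaToPowerSeries p (chromaticL c Lsharp Lflat * h)) :
    X8.MissingInputAt W p := by
  have hL : W.entireLFunction 1 ≠ 0 := (W.analyticRank_eq_zero_iff_holds (hmod W)).1 h0
  have hgood : W.HasGoodReductionAtPrime p := by
    obtain ⟨hp3, hss, _⟩ := hX
    subst hp3
    exact hss.1
  have hp2 : p ≠ 2 := by have := hX.1; omega
  have hlow : MissingLowerBoundAt W p :=
    missingLowerBoundAt_of_chromaticLowerDivisibility W p hGZK hp2 hgood (ClassX8.irr' W p hX) hL hf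
      hϖ hSP c (ClassX8.not_dvd_chromaticConst' W p hX c) ξ hK hdiv
  exact (X8.missingInputAt_iff_of_analyticRank_eq_zero W p hX h0).mpr
    ⟨fun _ ↦ hlow, fun hns ↦ absurd hs hns⟩

end Chain

end Summit.BirchSwinnertonDyer.Rank1Residual.Supersingular

end
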